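import Literature.AnabelianGeometry.SemiGraphs.ProSigmaCompletionDehnTwistCofinal
import Literature.GroupTheory.CombinatorialGroupTheory.PuncturedSurfaceGroupMixedCuspQuotients
import Literature.AnabelianGeometry.SemiGraphs.ProSigmaCompletionModels
import HarnessLib

/-!
# Pro-`Σ` completions, VII: the Dehn twist of `Γ_{0,4}` (non-vacuity of part VI)

Part VI (`ProSigmaCompletionDehnTwistCofinal.lean`) restricts pro-`Σ` completions of `Δ ⋊_φ ℤ` to the fibre `Δ`
when `φ(1)` is «Dehn-twist-shaped»: the identity on `A`, conjugation by a fixed `c` on `B`, `A ⊔ B = Δ`.  Here the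
shape is REALISED on the tree's punctured surface group `Γ_{0,4} = ⟨c₀,c₁,c₂,c₃ ∣ c₀c₁c₂c₃⟩`
(`PuncturedSurfaceGroup 0 4`, [SemiAnbd] Ex. 2.10): splitting the four-holed sphere along the loop `c₀c₁` into
two pairs of pants `A = ⟨c₀,c₁⟩`, `B = ⟨c₂,c₃⟩` (so `c := c₀c₁ = (c₂c₃)⁻¹ ∈ A ∩ B` is the node), the Dehn twist
along the node is the automorphism `τ : cᵢ ↦ cᵢ (i = 0,1)`, `c_j ↦ c·c_j·c⁻¹ (j = 2,3)` — well defined because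
`τ̃(c₀c₁c₂c₃) = c·(c₀c₁c₂c₃)·c⁻¹` ([AbsTopII] Def. 1.2 (ii): the PSC-extension of a pointed stable curve of
type `(0,4)` with one node acts on `Γ_{0,4}` through such twists).

* `SemidirectCofinal.exists_dehnTwist_genusZero_four` — the twist exists as a `MulAut (PuncturedSurfaceGroup 0 4)`
  with the four generator formulas;
* `SemidirectCofinal.exists_dehnTwist_genusZero_four_node₁₂` /
  `isProSigmaCompletion_closure_inl_genusZero_four_node₁₂` — the same two statements in the labelling of
  `PSCTwoTripodOrigin.lean` (node `c₁c₂`, pants `⟨c₁,c₂⟩`, `⟨c₃,c₀⟩`; there `Π_e = closure ι⟨c₁c₂⟩`);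
* `SemidirectCofinal.isProSigmaCompletion_closure_inl_genusZero_four` — for ANY `φ : ℤ → Aut Γ_{0,4}` whose
  `φ(1)` satisfies the four generator formulas and any pro-`Σ` completion `ι` of `Γ_{0,4} ⋊_φ ℤ` with profinite
  target, `ι ∘ inl : Γ_{0,4} → closure ι(inl Γ_{0,4})` is a pro-`Σ` completion (part VI with `A`, `B`, `c` above).
Theorems only; no side taken on [IUTchIII] Cor. 3.12. [cite: MochizukiSemiAnbd2006, Ex. 2.10 p.31]
-/

namespace Literature.AnabelianGeometry.SemiGraphs.SemiGraphOfAnabelioids.IsProSigmaCompletion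

open Literature.AnabelianGeometry.Anabelioids Topology
open Literature.GroupTheory.CombinatorialGroupTheory
open Literature.GroupTheory.CombinatorialGroupTheory.PuncturedSurfaceGroup

namespace SemidirectCofinal

variable {Sigma : Set ℕ}

/-- `finRange 4 = [0,1,2,3]`. [folklore] -/
private theorem finRange_four : List.finRange 4 = [0, 1, 2, 3] := by decide

/-- The surface relation of `Γ_{0,4}`: `c₂c₃ = (c₀c₁)⁻¹`. [folklore] -/
private theorem c_two_mul_c_three :
    (c 2 * c 3 : PuncturedSurfaceGroup 0 4) = (c 0 * c 1)⁻¹ := by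
  have h := prod_c_eq_one_of_genus_zero (r := 4)
  rw [finRange_four] at h
  simp only [List.map_cons, List.map_nil, List.prod_cons, List.prod_nil, mul_one] at h
  exact eq_inv_of_mul_eq_one_right (by simpa only [mul_assoc] using h)

/-- The two pants groups generate `Γ_{0,4}`. [folklore] -/
private theorem closure_sup_closure_eq_top :
    Subgroup.closure ({c 0, c 1} : Set (PuncturedSurfaceGroup 0 4)) ⊔ Subgroup.closure {c 2, c 3} = ⊤ := by
  refine (Subgroup.eq_top_iff' _).mpr fun x => PresentedGroup.generated_by _ _ (fun j => ?_) x
  rcases j with ⟨i, -⟩ | j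
  · exact i.elim0
  · change (c j : PuncturedSurfaceGroup 0 4) ∈ _
    by_cases hj : j = 0 ∨ j = 1
    · refine Subgroup.mem_sup_left (Subgroup.subset_closure ?_)
      rcases hj with rfl | rfl
      · exact Or.inl rfl
      · exact Or.inr rfl
    · have hj' : j = 2 ∨ j = 3 := by
        fin_cases j <;> simp_all
      refine Subgroup.mem_sup_right (Subgroup.subset_closure ?_)
      rcases hj' with rfl | rfl
      · exact Or.inl rfl
      · exact Or.inr rfl

/-- From the four generator formulas to the «partial conjugation» shape of part VI. [folklore] -/
private theorem shape_of_generators (τ : MulAut (PuncturedSurfaceGroup 0 4)) (h0 : τ (c 0) = c 0)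
    (h1 : τ (c 1) = c 1) (h2 : τ (c 2) = c 0 * c 1 * c 2 * (c 0 * c 1)⁻¹)
    (h3 : τ (c 3) = c 0 * c 1 * c 3 * (c 0 * c 1)⁻¹) :
    τ (c 0 * c 1) = c 0 * c 1 ∧
      (∀ a ∈ Subgroup.closure ({c 0, c 1} : Set (PuncturedSurfaceGroup 0 4)), τ a = a) ∧
      (∀ b ∈ Subgroup.closure ({c 2, c 3} : Set (PuncturedSurfaceGroup 0 4)),
        τ b = c 0 * c 1 * b * (c 0 * c 1)⁻¹) := by
  refine ⟨by rw [map_mul, h0, h1], fun a ha => ?_, fun b hb => ?_⟩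
  · have hs : Set.EqOn τ.toMonoidHom (MonoidHom.id (PuncturedSurfaceGroup 0 4))
        ({c 0, c 1} : Set (PuncturedSurfaceGroup 0 4)) := by
      rintro x (rfl | rfl)
      · exact h0
      · exact h1
    exact MonoidHom.eqOn_closure hs ha
  · have hs : Set.EqOn τ.toMonoidHom (MulAut.conj (c 0 * c 1 : PuncturedSurfaceGroup 0 4)).toMonoidHom
        ({c 2, c 3} : Set (PuncturedSurfaceGroup 0 4)) := by
      rintro x (rfl | rfl)
      · exact h2
      · exact h3
    exact MonoidHom.eqOn_closure hs hb

/-- **The Dehn twist of `Γ_{0,4}` along the node `c₀c₁` exists**: an automorphism `τ` of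
`PuncturedSurfaceGroup 0 4` with `τ c₀ = c₀`, `τ c₁ = c₁`, `τ c_j = (c₀c₁)·c_j·(c₀c₁)⁻¹` for `j = 2, 3`
(descends through the relator because `c₂c₃ = (c₀c₁)⁻¹`; the inverse twist conjugates by `(c₀c₁)⁻¹`).
[cite: MochizukiSemiAnbd2006, Ex. 2.10 p.31] -/
theorem exists_dehnTwist_genusZero_four :
    ∃ τ : MulAut (PuncturedSurfaceGroup 0 4),
      τ (c 0) = c 0 ∧ τ (c 1) = c 1 ∧ τ (c 2) = c 0 * c 1 * c 2 * (c 0 * c 1)⁻¹ ∧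
        τ (c 3) = c 0 * c 1 * c 3 * (c 0 * c 1)⁻¹ := by
  classical
  set cc : PuncturedSurfaceGroup 0 4 := c 0 * c 1 with hcc
  have h23 : (c 2 * c 3 : PuncturedSurfaceGroup 0 4) = cc⁻¹ := c_two_mul_c_three
  -- the twist and its inverse on generators
  let gm : puncturedSurfaceGen 0 4 → PuncturedSurfaceGroup 0 4 :=
    Sum.elim (fun p => p.1.elim0) fun j => if j = 0 ∨ j = 1 then c j else cc * c j * cc⁻¹
  let gm' : puncturedSurfaceGen 0 4 → PuncturedSurfaceGroup 0 4 :=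
    Sum.elim (fun p => p.1.elim0) fun j => if j = 0 ∨ j = 1 then c j else cc⁻¹ * c j * cc
  have hgm : ∀ w ∈ ({relator 0 4} : Set (FreeGroup (puncturedSurfaceGen 0 4))), FreeGroup.lift gm w = 1 := by
    intro w hw
    rw [Set.mem_singleton_iff] at hw
    rw [hw, lift_relator, List.finRange_zero, List.map_nil, List.prod_nil, one_mul, finRange_four]
    simp only [List.map_cons, List.map_nil, List.prod_cons, List.prod_nil, mul_one, gm, Sum.elim_inr]
    rw [if_pos (show True ∨ (0 : Fin 4) = 1 from Or.inl trivial),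
      if_pos (show (1 : Fin 4) = 0 ∨ True from Or.inr trivial),
      if_neg (show ¬((2 : Fin 4) = 0 ∨ (2 : Fin 4) = 1) by decide),
      if_neg (show ¬((3 : Fin 4) = 0 ∨ (3 : Fin 4) = 1) by decide)]
    have e : c 0 * (c 1 * (cc * c 2 * cc⁻¹ * (cc * c 3 * cc⁻¹))) = cc * (cc * (c 2 * c 3) * cc⁻¹) := by
      rw [hcc]; group
    rw [e, h23]; group
  have hgm' : ∀ w ∈ ({relator 0 4} : Set (FreeGroup (puncturedSurfaceGen 0 4))), FreeGroup.lift gm' w = 1 := by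
    intro w hw
    rw [Set.mem_singleton_iff] at hw
    rw [hw, lift_relator, List.finRange_zero, List.map_nil, List.prod_nil, one_mul, finRange_four]
    simp only [List.map_cons, List.map_nil, List.prod_cons, List.prod_nil, mul_one, gm', Sum.elim_inr]
    rw [if_pos (show True ∨ (0 : Fin 4) = 1 from Or.inl trivial),
      if_pos (show (1 : Fin 4) = 0 ∨ True from Or.inr trivial),
      if_neg (show ¬((2 : Fin 4) = 0 ∨ (2 : Fin 4) = 1) by decide),
      if_neg (show ¬((3 : Fin 4) = 0 ∨ (3 : Fin 4) = 1) by decide)]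
    have e : c 0 * (c 1 * (cc⁻¹ * c 2 * cc * (cc⁻¹ * c 3 * cc))) = cc * (cc⁻¹ * (c 2 * c 3) * cc) := by
      rw [hcc]; group
    rw [e, h23]; group
  let f : PuncturedSurfaceGroup 0 4 →* PuncturedSurfaceGroup 0 4 := PresentedGroup.toGroup hgm
  let f' : PuncturedSurfaceGroup 0 4 →* PuncturedSurfaceGroup 0 4 := PresentedGroup.toGroup hgm'
  have hf : ∀ j : Fin 4, f (c j) = if j = 0 ∨ j = 1 then c j else cc * c j * cc⁻¹ := fun j =>
    PresentedGroup.toGroup.of hgm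
  have hf' : ∀ j : Fin 4, f' (c j) = if j = 0 ∨ j = 1 then c j else cc⁻¹ * c j * cc := fun j =>
    PresentedGroup.toGroup.of hgm'
  have hfcc : f cc = cc := by
    rw [hcc, map_mul, hf, hf, if_pos (Or.inl rfl), if_pos (Or.inr rfl)]
  have hf'cc : f' cc = cc := by
    rw [hcc, map_mul, hf', hf', if_pos (Or.inl rfl), if_pos (Or.inr rfl)]
  have h₁ : f'.comp f = MonoidHom.id _ := by
    refine PresentedGroup.ext fun j => ?_
    rcases j with ⟨i, -⟩ | j
    · exact i.elim0
    · change f' (f (c j)) = c j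
      rw [hf]
      by_cases hj : j = 0 ∨ j = 1
      · rw [if_pos hj, hf', if_pos hj]
      · rw [if_neg hj, map_mul, map_mul, map_inv, hf'cc, hf', if_neg hj]
        group
  have h₂ : f.comp f' = MonoidHom.id _ := by
    refine PresentedGroup.ext fun j => ?_
    rcases j with ⟨i, -⟩ | j
    · exact i.elim0
    · change f (f' (c j)) = c j
      rw [hf']
      by_cases hj : j = 0 ∨ j = 1
      · rw [if_pos hj, hf, if_pos hj]
      · rw [if_neg hj, map_mul, map_mul, map_inv, hfcc, hf, if_neg hj]
        group
  refine ⟨MonoidHom.toMulEquiv f f' h₁ h₂, ?_, ?_, ?_, ?_⟩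
  · show f (c 0) = c 0
    rw [hf, if_pos (Or.inl rfl)]
  · show f (c 1) = c 1
    rw [hf, if_pos (Or.inr rfl)]
  · show f (c 2) = cc * c 2 * cc⁻¹
    rw [hf, if_neg (by decide)]
  · show f (c 3) = cc * c 3 * cc⁻¹
    rw [hf, if_neg (by decide)]

variable {P : Type*} [Group P] [TopologicalSpace P] [IsTopologicalGroup P] [CompactSpace P]
  [TotallyDisconnectedSpace P]

/-- **The fibre `Γ_{0,4}` of a Dehn-twist extension `Γ_{0,4} ⋊_φ ℤ` is pro-`Σ` completed by closure.**  If
`φ(1)` is the Dehn twist along the node `c₀c₁` (the four generator formulas), then for every pro-`Σ` completion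
`ι : Γ_{0,4} ⋊_φ ℤ → P` with profinite target, `ι ∘ inl : Γ_{0,4} → closure ι(inl Γ_{0,4})` is a pro-`Σ`
completion (part VI with `A = ⟨c₀,c₁⟩`, `B = ⟨c₂,c₃⟩`, `c = c₀c₁`). [cite: MochizukiSemiAnbd2006, Ex. 2.10 p.31] -/
theorem isProSigmaCompletion_closure_inl_genusZero_four
    {φ : Multiplicative ℤ →* MulAut (PuncturedSurfaceGroup 0 4)}
    (h0 : φ (Multiplicative.ofAdd 1) (c 0) = c 0) (h1 : φ (Multiplicative.ofAdd 1) (c 1) = c 1)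
    (h2 : φ (Multiplicative.ofAdd 1) (c 2) = c 0 * c 1 * c 2 * (c 0 * c 1)⁻¹)
    (h3 : φ (Multiplicative.ofAdd 1) (c 3) = c 0 * c 1 * c 3 * (c 0 * c 1)⁻¹)
    {ι : (PuncturedSurfaceGroup 0 4 ⋊[φ] Multiplicative ℤ) →* P} (hι : IsProSigmaCompletion Sigma ι) :
    IsProSigmaCompletion Sigma
      (((Subgroup.inclusion (Subgroup.le_topologicalClosure
        ((SemidirectProduct.inl :
          PuncturedSurfaceGroup 0 4 →* PuncturedSurfaceGroup 0 4 ⋊[φ] Multiplicative ℤ).range.map ι))).comp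
        (ι.subgroupMap (SemidirectProduct.inl :
          PuncturedSurfaceGroup 0 4 →* PuncturedSurfaceGroup 0 4 ⋊[φ] Multiplicative ℤ).range)).comp
        (MonoidHom.ofInjective (SemidirectProduct.inl_injective (φ := φ))).toMonoidHom) := by
  obtain ⟨hc, hA, hB⟩ := shape_of_generators (φ (Multiplicative.ofAdd 1)) h0 h1 h2 h3
  exact isProSigmaCompletion_closure_inl_of_partialConj hι _ _ closure_sup_closure_eq_top (c 0 * c 1) hc hA hB

/-! ### The same twist in the labelling of `PSCTwoTripodOrigin.lean`: node `c₁c₂`, pants `⟨c₁,c₂⟩`, `⟨c₃,c₀⟩` -/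

/-- The surface relation of `Γ_{0,4}`: `c₀c₁c₂c₃ = 1`. [folklore] -/
private theorem rel_genusZero_four : (c 0 * (c 1 * (c 2 * c 3)) : PuncturedSurfaceGroup 0 4) = 1 := by
  have h := prod_c_eq_one_of_genus_zero (r := 4)
  rw [finRange_four] at h
  simpa only [List.map_cons, List.map_nil, List.prod_cons, List.prod_nil, mul_one] using h

/-- The two pants groups `⟨c₁,c₂⟩`, `⟨c₃,c₀⟩` generate `Γ_{0,4}`. [folklore] -/
private theorem closure_sup_closure_eq_top' :
    Subgroup.closure ({c 1, c 2} : Set (PuncturedSurfaceGroup 0 4)) ⊔ Subgroup.closure {c 3, c 0} = ⊤ := by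
  refine (Subgroup.eq_top_iff' _).mpr fun x => PresentedGroup.generated_by _ _ (fun j => ?_) x
  rcases j with ⟨i, -⟩ | j
  · exact i.elim0
  · change (c j : PuncturedSurfaceGroup 0 4) ∈ _
    by_cases hj : j = 1 ∨ j = 2
    · refine Subgroup.mem_sup_left (Subgroup.subset_closure ?_)
      rcases hj with rfl | rfl
      · exact Or.inl rfl
      · exact Or.inr rfl
    · have hj' : j = 3 ∨ j = 0 := by
        fin_cases j <;> simp_all
      refine Subgroup.mem_sup_right (Subgroup.subset_closure ?_)
      rcases hj' with rfl | rfl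
      · exact Or.inl rfl
      · exact Or.inr rfl

/-- From the four generator formulas (node `c₁c₂`) to the «partial conjugation» shape of part VI. [folklore] -/
private theorem shape_of_generators' (τ : MulAut (PuncturedSurfaceGroup 0 4)) (h1 : τ (c 1) = c 1)
    (h2 : τ (c 2) = c 2) (h3 : τ (c 3) = c 1 * c 2 * c 3 * (c 1 * c 2)⁻¹)
    (h0 : τ (c 0) = c 1 * c 2 * c 0 * (c 1 * c 2)⁻¹) :
    τ (c 1 * c 2) = c 1 * c 2 ∧
      (∀ a ∈ Subgroup.closure ({c 1, c 2} : Set (PuncturedSurfaceGroup 0 4)), τ a = a) ∧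
      (∀ b ∈ Subgroup.closure ({c 3, c 0} : Set (PuncturedSurfaceGroup 0 4)),
        τ b = c 1 * c 2 * b * (c 1 * c 2)⁻¹) := by
  refine ⟨by rw [map_mul, h1, h2], fun a ha => ?_, fun b hb => ?_⟩
  · have hs : Set.EqOn τ.toMonoidHom (MonoidHom.id (PuncturedSurfaceGroup 0 4))
        ({c 1, c 2} : Set (PuncturedSurfaceGroup 0 4)) := by
      rintro x (rfl | rfl)
      · exact h1
      · exact h2
    exact MonoidHom.eqOn_closure hs ha
  · have hs : Set.EqOn τ.toMonoidHom (MulAut.conj (c 1 * c 2 : PuncturedSurfaceGroup 0 4)).toMonoidHom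
        ({c 3, c 0} : Set (PuncturedSurfaceGroup 0 4)) := by
      rintro x (rfl | rfl)
      · exact h3
      · exact h0
    exact MonoidHom.eqOn_closure hs hb

/-- **The Dehn twist of `Γ_{0,4}` along the node `c₁c₂`** — the labelling of the genuine two-tripod PSC datum of
`PSCTwoTripodOrigin.lean` (pants `⟨c₁,c₂⟩` and `⟨c₃,c₀⟩`, nodal subgroup `closure ι⟨c₁c₂⟩`): an automorphism
`τ` of `PuncturedSurfaceGroup 0 4` with `τ c₁ = c₁`, `τ c₂ = c₂`, `τ c_j = (c₁c₂)·c_j·(c₁c₂)⁻¹` for `j = 3, 0`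
(the relator is carried to its `c₁c₂`-conjugate; `c₃c₀ = (c₁c₂)⁻¹`). [cite: MochizukiSemiAnbd2006, Ex. 2.10 p.31] -/
theorem exists_dehnTwist_genusZero_four_node₁₂ :
    ∃ τ : MulAut (PuncturedSurfaceGroup 0 4),
      τ (c 1) = c 1 ∧ τ (c 2) = c 2 ∧ τ (c 3) = c 1 * c 2 * c 3 * (c 1 * c 2)⁻¹ ∧
        τ (c 0) = c 1 * c 2 * c 0 * (c 1 * c 2)⁻¹ := by
  classical
  set cc : PuncturedSurfaceGroup 0 4 := c 1 * c 2 with hcc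
  have hrel : (c 0 * (c 1 * c 2) * c 3 : PuncturedSurfaceGroup 0 4) = 1 := by
    simpa only [mul_assoc] using rel_genusZero_four
  -- the twist and its inverse on generators
  let gm : puncturedSurfaceGen 0 4 → PuncturedSurfaceGroup 0 4 :=
    Sum.elim (fun p => p.1.elim0) fun j => if j = 1 ∨ j = 2 then c j else cc * c j * cc⁻¹
  let gm' : puncturedSurfaceGen 0 4 → PuncturedSurfaceGroup 0 4 :=
    Sum.elim (fun p => p.1.elim0) fun j => if j = 1 ∨ j = 2 then c j else cc⁻¹ * c j * cc
  have hgm : ∀ w ∈ ({relator 0 4} : Set (FreeGroup (puncturedSurfaceGen 0 4))), FreeGroup.lift gm w = 1 := by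
    intro w hw
    rw [Set.mem_singleton_iff] at hw
    rw [hw, lift_relator, List.finRange_zero, List.map_nil, List.prod_nil, one_mul, finRange_four]
    simp only [List.map_cons, List.map_nil, List.prod_cons, List.prod_nil, mul_one, gm, Sum.elim_inr]
    rw [if_neg (show ¬((0 : Fin 4) = 1 ∨ (0 : Fin 4) = 2) by decide),
      if_pos (show True ∨ (1 : Fin 4) = 2 from Or.inl trivial),
      if_pos (show (2 : Fin 4) = 1 ∨ True from Or.inr trivial),
      if_neg (show ¬((3 : Fin 4) = 1 ∨ (3 : Fin 4) = 2) by decide)]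
    have e : cc * c 0 * cc⁻¹ * (c 1 * (c 2 * (cc * c 3 * cc⁻¹))) = cc * (c 0 * (c 1 * c 2) * c 3) * cc⁻¹ := by
      rw [hcc]; group
    rw [e, hrel]; group
  have hgm' : ∀ w ∈ ({relator 0 4} : Set (FreeGroup (puncturedSurfaceGen 0 4))), FreeGroup.lift gm' w = 1 := by
    intro w hw
    rw [Set.mem_singleton_iff] at hw
    rw [hw, lift_relator, List.finRange_zero, List.map_nil, List.prod_nil, one_mul, finRange_four]
    simp only [List.map_cons, List.map_nil, List.prod_cons, List.prod_nil, mul_one, gm', Sum.elim_inr]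
    rw [if_neg (show ¬((0 : Fin 4) = 1 ∨ (0 : Fin 4) = 2) by decide),
      if_pos (show True ∨ (1 : Fin 4) = 2 from Or.inl trivial),
      if_pos (show (2 : Fin 4) = 1 ∨ True from Or.inr trivial),
      if_neg (show ¬((3 : Fin 4) = 1 ∨ (3 : Fin 4) = 2) by decide)]
    have e : cc⁻¹ * c 0 * cc * (c 1 * (c 2 * (cc⁻¹ * c 3 * cc))) = cc⁻¹ * (c 0 * (c 1 * c 2) * c 3) * cc := by
      rw [hcc]; group
    rw [e, hrel]; group
  let f : PuncturedSurfaceGroup 0 4 →* PuncturedSurfaceGroup 0 4 := PresentedGroup.toGroup hgm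
  let f' : PuncturedSurfaceGroup 0 4 →* PuncturedSurfaceGroup 0 4 := PresentedGroup.toGroup hgm'
  have hf : ∀ j : Fin 4, f (c j) = if j = 1 ∨ j = 2 then c j else cc * c j * cc⁻¹ := fun j =>
    PresentedGroup.toGroup.of hgm
  have hf' : ∀ j : Fin 4, f' (c j) = if j = 1 ∨ j = 2 then c j else cc⁻¹ * c j * cc := fun j =>
    PresentedGroup.toGroup.of hgm'
  have hfcc : f cc = cc := by
    rw [hcc, map_mul, hf, hf, if_pos (Or.inl rfl), if_pos (Or.inr rfl)]
  have hf'cc : f' cc = cc := by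
    rw [hcc, map_mul, hf', hf', if_pos (Or.inl rfl), if_pos (Or.inr rfl)]
  have h₁ : f'.comp f = MonoidHom.id _ := by
    refine PresentedGroup.ext fun j => ?_
    rcases j with ⟨i, -⟩ | j
    · exact i.elim0
    · change f' (f (c j)) = c j
      rw [hf]
      by_cases hj : j = 1 ∨ j = 2
      · rw [if_pos hj, hf', if_pos hj]
      · rw [if_neg hj, map_mul, map_mul, map_inv, hf'cc, hf', if_neg hj]
        group
  have h₂ : f.comp f' = MonoidHom.id _ := by
    refine PresentedGroup.ext fun j => ?_
    rcases j with ⟨i, -⟩ | j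
    · exact i.elim0
    · change f (f' (c j)) = c j
      rw [hf']
      by_cases hj : j = 1 ∨ j = 2
      · rw [if_pos hj, hf, if_pos hj]
      · rw [if_neg hj, map_mul, map_mul, map_inv, hfcc, hf, if_neg hj]
        group
  refine ⟨MonoidHom.toMulEquiv f f' h₁ h₂, ?_, ?_, ?_, ?_⟩
  · show f (c 1) = c 1
    rw [hf, if_pos (Or.inl rfl)]
  · show f (c 2) = c 2
    rw [hf, if_pos (Or.inr rfl)]
  · show f (c 3) = cc * c 3 * cc⁻¹
    rw [hf, if_neg (by decide)]
  · show f (c 0) = cc * c 0 * cc⁻¹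
    rw [hf, if_neg (by decide)]

/-- **The fibre `Γ_{0,4}` of the Dehn-twist extension along the node `c₁c₂` is pro-`Σ` completed by closure**
(the labelling of `PSCTwoTripodOrigin.lean`): for `φ(1)` given by the four generator formulas of
`exists_dehnTwist_genusZero_four_node₁₂` and every pro-`Σ` completion `ι : Γ_{0,4} ⋊_φ ℤ → P` with profinite
target, `ι ∘ inl : Γ_{0,4} → closure ι(inl Γ_{0,4})` is a pro-`Σ` completion of `Γ_{0,4}` — so the two-tripod
PSC data of `PSCTwoTripodOrigin.lean` can be formed over `closure ι(inl Γ_{0,4})` inside a pro-`Σ` completion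
of the twisted extension. [cite: MochizukiSemiAnbd2006, Ex. 2.10 p.31] -/
theorem isProSigmaCompletion_closure_inl_genusZero_four_node₁₂
    {φ : Multiplicative ℤ →* MulAut (PuncturedSurfaceGroup 0 4)}
    (h1 : φ (Multiplicative.ofAdd 1) (c 1) = c 1) (h2 : φ (Multiplicative.ofAdd 1) (c 2) = c 2)
    (h3 : φ (Multiplicative.ofAdd 1) (c 3) = c 1 * c 2 * c 3 * (c 1 * c 2)⁻¹)
    (h0 : φ (Multiplicative.ofAdd 1) (c 0) = c 1 * c 2 * c 0 * (c 1 * c 2)⁻¹)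
    {ι : (PuncturedSurfaceGroup 0 4 ⋊[φ] Multiplicative ℤ) →* P} (hι : IsProSigmaCompletion Sigma ι) :
    IsProSigmaCompletion Sigma
      (((Subgroup.inclusion (Subgroup.le_topologicalClosure
        ((SemidirectProduct.inl :
          PuncturedSurfaceGroup 0 4 →* PuncturedSurfaceGroup 0 4 ⋊[φ] Multiplicative ℤ).range.map ι))).comp
        (ι.subgroupMap (SemidirectProduct.inl :
          PuncturedSurfaceGroup 0 4 →* PuncturedSurfaceGroup 0 4 ⋊[φ] Multiplicative ℤ).range)).comp
        (MonoidHom.ofInjective (SemidirectProduct.inl_injective (φ := φ))).toMonoidHom) := by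
  obtain ⟨hc, hA, hB⟩ := shape_of_generators' (φ (Multiplicative.ofAdd 1)) h1 h2 h3 h0
  exact isProSigmaCompletion_closure_inl_of_partialConj hι _ _ closure_sup_closure_eq_top' (c 1 * c 2) hc hA hB

/-- **Inhabited input for the nodal DPSC model of type `(0,4)`, every `Σ`.**  There are `φ : ℤ → Aut Γ_{0,4}`
with `φ(1)` the Dehn twist along the node `c₁c₂`, a profinite group `P` and a pro-`Σ` completion
`ι : Γ_{0,4} ⋊_φ ℤ → P` (`ProSigmaCompletionModels.exists_isProSigmaCompletion`); by the `node₁₂` theorem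
`ι ∘ inl` is then a pro-`Σ` completion of `Γ_{0,4}` onto `closure ι(inl Γ_{0,4})`, over which the two-tripod PSC
data of `PSCTwoTripodOrigin.lean` are formed. [cite: MochizukiSemiAnbd2006, Ex. 2.10 p.31] -/
theorem exists_dehnTwist_extension_proSigmaCompletion (Sigma : Set ℕ) :
    ∃ (φ : Multiplicative ℤ →* MulAut (PuncturedSurfaceGroup 0 4)) (P : ProfiniteGrp.{0})
      (ι : (PuncturedSurfaceGroup 0 4 ⋊[φ] Multiplicative ℤ) →* P),
      φ (Multiplicative.ofAdd 1) (c 1) = c 1 ∧ φ (Multiplicative.ofAdd 1) (c 2) = c 2 ∧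
        φ (Multiplicative.ofAdd 1) (c 3) = c 1 * c 2 * c 3 * (c 1 * c 2)⁻¹ ∧
        φ (Multiplicative.ofAdd 1) (c 0) = c 1 * c 2 * c 0 * (c 1 * c 2)⁻¹ ∧
        IsProSigmaCompletion Sigma ι ∧
        IsProSigmaCompletion Sigma
          (((Subgroup.inclusion (Subgroup.le_topologicalClosure
            ((SemidirectProduct.inl :
              PuncturedSurfaceGroup 0 4 →* PuncturedSurfaceGroup 0 4 ⋊[φ] Multiplicative ℤ).range.map ι))).comp
            (ι.subgroupMap (SemidirectProduct.inl :
              PuncturedSurfaceGroup 0 4 →* PuncturedSurfaceGroup 0 4 ⋊[φ] Multiplicative ℤ).range)).comp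
            (MonoidHom.ofInjective (SemidirectProduct.inl_injective (φ := φ))).toMonoidHom) := by
  obtain ⟨τ, h1, h2, h3, h0⟩ := exists_dehnTwist_genusZero_four_node₁₂
  have hφ : zpowersHom (MulAut (PuncturedSurfaceGroup 0 4)) τ (Multiplicative.ofAdd 1) = τ := by
    rw [zpowersHom_apply, toAdd_ofAdd, zpow_one]
  obtain ⟨P, ι, hι⟩ := exists_isProSigmaCompletion
    (PuncturedSurfaceGroup 0 4 ⋊[zpowersHom (MulAut (PuncturedSurfaceGroup 0 4)) τ] Multiplicative ℤ) Sigma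
  rw [← hφ] at h1 h2 h3 h0
  exact ⟨_, P, ι, h1, h2, h3, h0, hι, isProSigmaCompletion_closure_inl_genusZero_four_node₁₂ h1 h2 h3 h0 hι⟩

end SemidirectCofinal

end Literature.AnabelianGeometry.SemiGraphs.SemiGraphOfAnabelioids.IsProSigmaCompletion
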